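import Summits.BirchSwinnertonDyer.BirchSwinnertonDyer.Theses.CountingDoorF2AtThree
import Summits.BirchSwinnertonDyer.Rank2.CountingDoorKernel
import HarnessLib

/-!
# BirchSwinnertonDyer / CountingDoorF2AtThree — support item `DoorKernelAtThree`
# (stmt-BirchSwinnertonDyer-19483): PROVED

The per-member door kernel at `p = 3` of route `route-BirchSwinnertonDyer-CountingDoorF2AtThree`
(cell bsd-rank2, TWIN leaf `PAdicBSDRankTwoPositiveProportion`): under the route's fact pack
`PublishedInputsAtThree` (whose conjuncts are, up to unfolding, the tree's named facts
`Schneider1985_order_charGenerator_odd`, `mazur_tate_sigma_exists_odd`,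
`even_selmerRank_sub_torsionRank_iff` and `skinner_urban_main_conjecture · 3`), a globally minimal
elliptic `W/ℚ`, good ordinary at `3`, with `ρ̄₃` irreducible, an auxiliary multiplicative prime
`ℓ ≠ 3` with `3 ∤ v_ℓ(Δ_min)`, Schneider's conjecture at `3`, `#Sel₃(W) = 9` and `rank W(ℚ) ≥ 2`
has `rank W(ℚ) = 2`, `Ш(W)[3^∞] = 0` and `ord_{T=0} L₃(f, α; T) = 2` for every weight-two newform
`f` of `W`. The mathematics is the cell-topic theorem
`Summit.BirchSwinnertonDyer.Rank2.doorKernel_at_three` (`Summits/BirchSwinnertonDyer/Rank2/CountingDoorKernel.lean`: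
kernels K1 `#Sel_p = p² ⇒ rank = 2 ∧ Ш[p^∞] = 0` and K4 `… ⇒ ord_T L_p = 2` of
`HOME/p2/PADIC-R2-G8.md` §3); this file only feeds it the first, second and fourth conjuncts of
`PublishedInputsAtThree`. B1 honesty: TWIN currency — the order of the cyclotomic `3`-adic
`L`-function is read off the algebraic side through the main conjecture; no analytic rank is read.
-/

set_option linter.dupNamespace false

namespace Summit.BirchSwinnertonDyer.BirchSwinnertonDyer.Theorems

/-- **`DoorKernelAtThree` holds** (stmt-BirchSwinnertonDyer-19483): modus ponens on
`Summit.BirchSwinnertonDyer.Rank2.doorKernel_at_three` with the Schneider-1985, Mazur–Tate-σ and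
Skinner–Urban conjuncts of `PublishedInputsAtThree`. [cite: SkinnerUrban2014, Thm 3.29] -/
theorem doorKernelAtThree :
    Summit.BirchSwinnertonDyer.BirchSwinnertonDyer.Theses.CountingDoorF2AtThree.DoorKernelAtThree :=
  fun hIn W _ _ hord hirr haux hR hSel h2 ↦
    Summit.BirchSwinnertonDyer.Rank2.doorKernel_at_three hIn.1 hIn.2.1 hIn.2.2.2 W hord hirr haux hR
      hSel h2

end Summit.BirchSwinnertonDyer.BirchSwinnertonDyer.Theorems
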